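import Summits.BirchSwinnertonDyer.BirchSwinnertonDyer.Theorems.SmallImageMuTransferMuTransferX9SelmerDualLocalP
import HarnessLib

/-!
# Route ByReductionTypeAtTwo, crux `OrdKatoHalfAtTwoIso` (stmt-BirchSwinnertonDyer-19573), line
# `steinberg-fibre-at-two`: the Selmer-side stub `hG1` of the odd core WITHOUT `p ≠ 2`, part 1 (local at `p`)

Seat `cruxlead-stmt-BirchSwinnertonDyer-19573-g0` (LEAD PROVER, MODE LINE), helper W2c (PLAN C).
HONEST FRAMING (cell bsd-2adic): BSD is not proved; the crux `OrdKatoHalfAtTwoIso` is not proved; `stub_port`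
is not proved here. Theorems only (no definition, no named fact, no `sorry`); nothing is asserted about any
curve and nothing is booked (`--supports stmt-BirchSwinnertonDyer-19573 --as helper`).

WHY. The odd-prime kernel core `X10.coreTheoremAOddPrime_holds` is being ported to `p = 2` (`stub_port` of
line `steinberg-fibre-at-two`). Its Selmer-side input `hG1 = SelmerDual.stub_selmerDualOdd_holds`
(`…X9SelmerDualStub`) carries the binder `p ≠ 2`, and the lead traced that binder to ONE consumer:
`SelmerDual.iterate_conj_sub_id_eq_zero_of_pow (hp2 : p ≠ 2)` (unipotent ⟹ nilpotent on a `p`-torsion group,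
`…X9SelmerDualLocalFineNil`), reached through `exists_uniform_local_exponent → …_resLe → localP_of → localP`.
That arithmetic holds at EVERY prime — in `End(V)` with `p V = 0`, `g^{pⁿ} = ((g − 1) + 1)^{pⁿ} =
(g − 1)^{pⁿ} + 1 + p (…)` (W2a's `AtTwo.iterate_sub_id_eq_zero_of_prime_pow`, file `…PortEngines`; a private copy
`iterate_sub_id_eq_zero_of_prime_pow_aux` is kept here only to decouple the build order of the two helper
files) — so the whole chain re-runs verbatim with `hp2` deleted. This file is the ALL-PRIME twin of the
local-at-`p` half of the chain; every proof is the odd proof with `hp2` struck from binders and calls: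

* `exists_uniform_local_exponent'` — twin of `exists_uniform_local_exponent` (k6-c2 p465054's part 3): the
  uniform exponent `ε = #E[p] + #B₁` killing the restriction to `D_v ∩ Gal(K̄/K_n)` of `(conj_γ − 1)^{[ε]} y_n`
  for every layer `n` and every `y_n` whose restriction to `K_∞` is FINE, at a place `v` totally ramified in
  the `ℤ_p`-extension `κ`.
* `exists_uniform_local_exponent_resLe'` — the same in the currency of `ContinuousCorestriction.resLe`.
* `localP_of'` — twin of `localP_of` (k6-c2): hypothesis (L-p) of the Selmer-side assembly at a place `v ∣ p`
  of `ℚ`, from (Lp-2) total ramification `hsurj` and (Lp-3) the local embed-kernel exponent `h3`.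

Parts 2–3 (`…SelmerDualAllPrimePlaces`, `…SelmerDualAllPrime`) assemble the all-prime `hG1`. Credit: sidea-stub_port-1 STUB-IDEAS-1
@82c64e14eec0e2be Plan C («near-verbatim; `hp2` is consumed only by the iterate lemma, true at 2 by
Frobenius»); the odd files of seat bsd-smallim-k6-c2 (p465054, p465845).

References: HOME/koly/MU-TRANSFER-PROOF.md §5 STEP 1; R. Greenberg, LNM 1716 (1999) §3 [GreenbergLNM1716];
J. Neukirch, A. Schmidt, K. Wingberg (2008) I §5 [NeukirchSchmidtWingberg2008].
-/

set_option linter.dupNamespace false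
set_option autoImplicit false

noncomputable section

open scoped NumberField
open Field IsDedekindDomain Function CategoryTheory
open WeierstrassCurve (geomTorsion geomPrimaryTorsion geomTorsion_le_geomPrimaryTorsion)
open Literature.NumberTheory.GaloisRepresentations
open Literature.NumberTheory.EllipticCurves
open Literature.NumberTheory.EllipticCurves.GreenbergSelmer
open Summit.BirchSwinnertonDyer.Rank1Residual.X11b

universe u

namespace Summit.BirchSwinnertonDyer.BirchSwinnertonDyer.Rank1Residual.SelmerDual

/-! ## Unipotent ⟹ nilpotent on a `p`-torsion group, every prime -/

section Unipotent

-- adapted from W2a's `AtTwo.iterate_sub_id_eq_zero_of_prime_pow` (…OrdKatoHalfAtTwoIsoPortEngines): private copy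
/-- On an additive group killed by the prime `p` (ANY prime), an additive endomorphism `g` with
`g^{[pⁿ]} = id` satisfies `(g − id)^{[pⁿ]} = 0`: in the ring `End(V)`,
`g^{pⁿ} = ((g − 1) + 1)^{pⁿ} = (g − 1)^{pⁿ} + 1 + p (g − 1) r` (`Commute.exists_add_pow_prime_pow_eq`) and
`p = 0` on `V`. [folklore] -/
private theorem iterate_sub_id_eq_zero_of_prime_pow_aux {V : Type*} [AddCommGroup V] {p : ℕ}
    [hp : Fact p.Prime] (hV : ∀ v : V, p • v = 0) (g : V →+ V) {n : ℕ} (hg : ∀ v, g^[p ^ n] v = v)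
    (v : V) : (⇑(g - AddMonoidHom.id V))^[p ^ n] v = 0 := by
  -- in the ring `AddMonoid.End V`
  let G : AddMonoid.End V := g
  obtain ⟨r, hr⟩ := Commute.exists_add_pow_prime_pow_eq hp.out (Commute.one_right (G - 1)) n
  rw [sub_add_cancel, one_pow, mul_one] at hr
  -- `hr : G ^ p ^ n = (G - 1) ^ p ^ n + 1 + p * (G - 1) * r`
  have hpow : ∀ (X : AddMonoid.End V) (k : ℕ) (w : V), (X ^ k) w = (⇑X)^[k] w := fun X k w => by
    rw [AddMonoid.End.coe_pow]
  have hfun : ⇑(g - AddMonoidHom.id V) = ⇑(G - 1) := rfl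
  have hGv : (G ^ p ^ n) v = v := by rw [hpow]; exact hg v
  have hpr : ((p : AddMonoid.End V) * (G - 1) * r) v = 0 := by
    rw [mul_assoc, AddMonoid.End.coe_mul, Function.comp_apply, AddMonoid.End.natCast_apply, hV]
  have key : ((G - 1) ^ p ^ n) v + v + ((p : AddMonoid.End V) * (G - 1) * r) v = v := by
    have h := congrArg (fun X : AddMonoid.End V => X v) hr
    rw [hGv] at h
    exact h.symm
  rw [hpr, add_zero, add_eq_right] at key
  rw [hfun, ← hpow, key]

end Unipotent

/-! ## The uniform local exponent at a totally ramified place above `p`, every prime -/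

section Main

variable {K : Type u} [Field K] [NumberField K] (W : WeierstrassCurve K) [W.IsElliptic] {p : ℕ}
  [hp : Fact p.Prime] (κ : ZpExtension K p) (v : HeightOneSpectrum (𝓞 K))

-- adapted from `SelmerDual.exists_uniform_local_exponent` (…X9SelmerDualLocalFineNil, k6-c2): `hp2` deleted,
-- the one call `iterate_conj_sub_id_eq_zero_of_pow hp2` replaced by the all-prime `iterate_sub_id_eq_zero_of_prime_pow_aux`
/-- **Uniform local exponent at a totally ramified place, EVERY prime `p` (no `p ≠ 2`).** Let `κ` be a
`ℤ_p`-extension of the number field `K` with a topological generator `γ̃ ∈ D_v` and `κ(D_v) = ℤ_p`, `E = W` an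
elliptic curve, `γ ∈ Γ_K` arbitrary.  There is `ε` (namely `#E[p] + #B₁`, `B₁` the local Kummer kernel at `v`) such that for every layer
`n` and every `y_n ∈ H¹(Gal(K̄/K_n), E[p])` whose restriction to `D_v ∩ Gal(K̄/K_∞)` lies in `B₁` (e.g. the
restriction of `y_n` to `K_∞` is FINE, part 1), the restriction of `(conj_γ − 1)^{[ε]} y_n` to
`D_v ∩ Gal(K̄/K_n)` vanishes.  The odd twin's only use of `p ≠ 2` was the unipotent ⟹ nilpotent step
`(g − id)^{[pⁿ]} = 0`, which holds at every prime (`(g − 1)^{pⁿ} = g^{pⁿ} − 1` in `End(V)` when `p V = 0`;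
at `p = 2`: `−1 = 1`). [cite: GreenbergLNM1716, §3 Lemma 3.1] -/
theorem exists_uniform_local_exponent' {γt : absoluteGaloisGroup K}
    (hγt : κ.IsTopGenerator γt) (hγtD : γt ∈ decomp v)
    (hsurj : ∀ g : absoluteGaloisGroup K, ∃ d ∈ decomp v, d⁻¹ * g ∈ κ.kerSubgroup)
    (γ : absoluteGaloisGroup K) :
    ∃ ε : ℕ, ∀ (n : ℕ) (yn : subgroupH1 (κ.layerSubgroup n) (geomTorsion W (p : ℤ))),
      resH1Hom (decompInToH κ.kerSubgroup v) (AddMonoidHom.id (geomTorsion W (p : ℤ))) (fun _ _ => rfl)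
          (resOfLe (geomTorsion W (p : ℤ)) (κ.kerSubgroup_le_layerSubgroup n) yn) ∈
        (resH1Hom (ContinuousMonoidHom.id (decompIn κ.kerSubgroup v))
          (AddSubgroup.inclusion (geomTorsion_le_geomPrimaryTorsion W p)) (fun _ _ => rfl) :
            subgroupH1 (decompIn κ.kerSubgroup v) (geomTorsion W (p : ℤ)) →+
              subgroupH1 (decompIn κ.kerSubgroup v) (geomPrimaryTorsion W p)).ker →
      resH1Hom (decompInToH (κ.layerSubgroup n) v) (AddMonoidHom.id (geomTorsion W (p : ℤ))) (fun _ _ => rfl)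
        ((⇑(conjH1 (κ.layerSubgroup n) (geomTorsion W (p : ℤ)) γ -
          AddMonoidHom.id (subgroupH1 (κ.layerSubgroup n) (geomTorsion W (p : ℤ)))))^[ε] yn) = 0 := by
  classical
  have hcont : ∀ m : geomTorsion W (p : ℤ), Continuous fun g : absoluteGaloisGroup K => g • m := fun m =>
    continuous_smul_of_isOpen_stabilizer m (W.isOpen_stabilizer_geomTorsion (p : ℤ) m)
  have hMp : ∀ m : geomTorsion W (p : ℤ), p • m = 0 := fun m => AddSubgroup.torsionBy.nsmul m
  haveI : Finite (geomTorsion W (p : ℤ)) :=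
    WeierstrassCurve.finite_torsionPoints_holds W (AlgebraicClosure K)
      (Int.natCast_ne_zero.mpr hp.out.ne_zero)
  -- the finite local Kummer kernel `B₁`
  set B₁ := (resH1Hom (ContinuousMonoidHom.id (decompIn κ.kerSubgroup v))
      (AddSubgroup.inclusion (geomTorsion_le_geomPrimaryTorsion W p)) (fun _ _ => rfl) :
        subgroupH1 (decompIn κ.kerSubgroup v) (geomTorsion W (p : ℤ)) →+
          subgroupH1 (decompIn κ.kerSubgroup v) (geomPrimaryTorsion W p)).ker with hB₁
  haveI hB₁fin : Finite B₁ := (finite_ker_localTorsionToPrimary W p v κ.kerSubgroup).to_subtype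
  refine ⟨Nat.card (geomTorsion W (p : ℤ)) + Nat.card B₁, fun n yn hfine => ?_⟩
  haveI : (decompIn κ.kerSubgroup v).Normal := decompIn_normal κ.kerSubgroup v
  haveI : (decompIn (κ.layerSubgroup n) v).Normal := decompIn_normal (κ.layerSubgroup n) v
  have h := decompIn_mono v (κ.kerSubgroup_le_layerSubgroup n)
  -- the inflation kernel (part 2) and `V = res⁻¹(B₁)`
  obtain ⟨hK₂fin, hK₂le⟩ := finite_ker_resOfLe_decompIn_and_card_le κ v hcont hγt hγtD hsurj n
  haveI := hK₂fin
  obtain ⟨hVfin, hVle⟩ := natCard_comap_le_mul (resOfLe (geomTorsion W (p : ℤ)) h) B₁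
  set V := B₁.comap (resOfLe (geomTorsion W (p : ℤ)) h) with hV
  haveI : Finite V := hVfin
  -- `z = res y_n ∈ V`
  set z := resH1Hom (decompInToH (κ.layerSubgroup n) v) (AddMonoidHom.id (geomTorsion W (p : ℤ)))
    (fun _ _ => rfl) yn with hz
  have hzV : z ∈ V := by
    rw [hV, AddSubgroup.mem_comap, hz, resOfLe_decompIn_resH1Hom_decompInToH]
    exact hfine
  -- the conjugating element inside `D_v`
  obtain ⟨d, hdD, hdγ⟩ := hsurj γ
  let dD : decomp v := ⟨d, hdD⟩
  set g := conjH1 (decompIn (κ.layerSubgroup n) v) (geomTorsion W (p : ℤ)) dD with hg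
  -- `V` is `g`-stable
  have hB₁stab : ∀ b ∈ B₁, conjH1 (decompIn κ.kerSubgroup v) (geomTorsion W (p : ℤ)) dD b ∈ B₁ :=
    fun b hb => by
    rw [hB₁, AddMonoidHom.mem_ker] at hb ⊢
    rw [resH1Hom_id_conjH1 (decompIn κ.kerSubgroup v) _ (fun _ _ => rfl) dD b, hb, map_zero]
  have hVstab : ∀ w ∈ V, g w ∈ V := fun w hw => by
    rw [hV, AddSubgroup.mem_comap] at hw ⊢
    rw [hg, show resOfLe (geomTorsion W (p : ℤ)) h (conjH1 _ _ dD w) =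
        conjH1 (decompIn κ.kerSubgroup v) _ dD (resOfLe _ h w) from
      DFunLike.congr_fun (resOfLe_comp_conjH1_holds (M := geomTorsion W (p : ℤ)) h dD) w]
    exact hB₁stab _ hw
  -- `g` restricted to `V`; unipotence `g^{[p^n]} = id` (inner action of `d^{p^n} ∈ D_v ∩ Gal(K̄/K_n)`)
  let gV : V →+ V := (g.comp V.subtype).codRestrict V (fun w => hVstab w w.2)
  have hgV : ∀ (k : ℕ) (w : V), ((gV^[k] w : V) : subgroupH1 (decompIn (κ.layerSubgroup n) v)
      (geomTorsion W (p : ℤ))) = g^[k] (w : subgroupH1 (decompIn (κ.layerSubgroup n) v) (geomTorsion W (p : ℤ))) := by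
    intro k
    induction k with
    | zero => intro w; rfl
    | succ k ih => intro w; rw [iterate_succ_apply', iterate_succ_apply', ← ih]; rfl
  have hTV : ∀ (k : ℕ) (w : V), (((⇑(gV - AddMonoidHom.id V))^[k] w : V) :
      subgroupH1 (decompIn (κ.layerSubgroup n) v) (geomTorsion W (p : ℤ))) =
      (⇑(g - AddMonoidHom.id (subgroupH1 (decompIn (κ.layerSubgroup n) v) (geomTorsion W (p : ℤ)))))^[k]
        (w : subgroupH1 (decompIn (κ.layerSubgroup n) v) (geomTorsion W (p : ℤ))) := by
    intro k
    induction k with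
    | zero => intro w; rfl
    | succ k ih => intro w; rw [iterate_succ_apply', iterate_succ_apply', ← ih]; rfl
  have hdn : (dD : decomp v) ^ p ^ n ∈ decompIn (κ.layerSubgroup n) v := by
    rw [mem_decompIn_iff]
    push_cast
    exact pow_prime_pow_mem_layerSubgroup κ d n
  have hunip : ∀ w : V, gV^[p ^ n] w = w := fun w => by
    apply Subtype.ext
    rw [hgV, hg, conjH1_iterate, conjH1_of_mem_holds _ _ hdn]
    rfl
  have hVp : ∀ w : V, p • w = 0 := fun w =>
    Subtype.ext (by
      rw [AddSubgroupClass.coe_nsmul, ZeroMemClass.coe_zero]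
      exact prime_smul_subgroupH1_eq_zero hMp
        (w : subgroupH1 (decompIn (κ.layerSubgroup n) v) (geomTorsion W (p : ℤ))))
  have hnil : ∀ w : V, (⇑(gV - AddMonoidHom.id V))^[p ^ n] w = 0 :=
    iterate_sub_id_eq_zero_of_prime_pow_aux hVp gV hunip
  -- Cayley–Hamilton on the finite `𝔽_p`-space `V`
  have hp1 : 1 < p := hp.out.one_lt
  have hε : Nat.card V ≤ p ^ (Nat.card (geomTorsion W (p : ℤ)) + Nat.card B₁) :=
    calc Nat.card V ≤ Nat.card (resOfLe (geomTorsion W (p : ℤ)) h).ker * Nat.card B₁ := hVle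
      _ ≤ Nat.card (geomTorsion W (p : ℤ)) * Nat.card B₁ := Nat.mul_le_mul_right _ hK₂le
      _ ≤ p ^ Nat.card (geomTorsion W (p : ℤ)) * p ^ Nat.card B₁ :=
        Nat.mul_le_mul (Nat.lt_pow_self hp1).le (Nat.lt_pow_self hp1).le
      _ = p ^ (Nat.card (geomTorsion W (p : ℤ)) + Nat.card B₁) := (pow_add _ _ _).symm
  have hkill := LocalSplitPrime.iterate_eq_zero_of_nilpotent_of_natCard_le hVp (gV - AddMonoidHom.id V)
    hnil hε ⟨z, hzV⟩
  have hz0 : (⇑(g - AddMonoidHom.id (subgroupH1 (decompIn (κ.layerSubgroup n) v)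
      (geomTorsion W (p : ℤ)))))^[Nat.card (geomTorsion W (p : ℤ)) + Nat.card B₁] z = 0 := by
    have := congrArg Subtype.val hkill
    rwa [hTV] at this
  -- back to `conj_γ` on `H¹(Gal(K̄/K_n), M)`: `conj_γ = conj_d` there (`d⁻¹ γ ∈ Gal(K̄/K_∞)`)
  have hγd : conjH1 (κ.layerSubgroup n) (geomTorsion W (p : ℤ)) γ =
      conjH1 (κ.layerSubgroup n) (geomTorsion W (p : ℤ)) d := by
    have : γ = d * (d⁻¹ * γ) := by group
    rw [this, conjH1_mul_holds, conjH1_of_mem_holds _ _ (κ.kerSubgroup_le_layerSubgroup n hdγ)]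
    rfl
  rw [hγd, map_iterate_sub_id (resH1Hom (decompInToH (κ.layerSubgroup n) v)
    (AddMonoidHom.id (geomTorsion W (p : ℤ))) (fun _ _ => rfl)) (conjH1 (κ.layerSubgroup n) _ d) g
    (fun a => by rw [hg]; exact resH1Hom_decompInToH_conjH1 v (κ.layerSubgroup n) dD a)]
  exact hz0

-- adapted from `SelmerDual.exists_uniform_local_exponent_resLe` (…X9SelmerDualLocalFineNil): `hp2` deleted
/-- **The uniform local exponent (every prime), in the currency of `ContinuousCorestriction`** (`resLe` to
`D_v ⊓ Gal(K̄/K_n)`), ready for the one-double-coset Mackey formula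
`resSubgroup_cores_eq_zero_of_resLe_eq_zero`. [cite: GreenbergLNM1716, §3 Lemma 3.1] -/
theorem exists_uniform_local_exponent_resLe' {γt : absoluteGaloisGroup K}
    (hγt : κ.IsTopGenerator γt) (hγtD : γt ∈ decomp v)
    (hsurj : ∀ g : absoluteGaloisGroup K, ∃ d ∈ decomp v, d⁻¹ * g ∈ κ.kerSubgroup)
    (γ : absoluteGaloisGroup K) :
    ∃ ε : ℕ, ∀ (n : ℕ) (yn : subgroupH1 (κ.layerSubgroup n) (geomTorsion W (p : ℤ))),
      resH1Hom (decompInToH κ.kerSubgroup v) (AddMonoidHom.id (geomTorsion W (p : ℤ))) (fun _ _ => rfl)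
          (resOfLe (geomTorsion W (p : ℤ)) (κ.kerSubgroup_le_layerSubgroup n) yn) ∈
        (resH1Hom (ContinuousMonoidHom.id (decompIn κ.kerSubgroup v))
          (AddSubgroup.inclusion (geomTorsion_le_geomPrimaryTorsion W p)) (fun _ _ => rfl) :
            subgroupH1 (decompIn κ.kerSubgroup v) (geomTorsion W (p : ℤ)) →+
              subgroupH1 (decompIn κ.kerSubgroup v) (geomPrimaryTorsion W p)).ker →
      resLe (W.torsionGaloisModule (p : ℤ)).toTopRep
          (inf_le_right : decomp v ⊓ κ.layerSubgroup n ≤ κ.layerSubgroup n) 1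
        ((⇑(conjH1 (κ.layerSubgroup n) (geomTorsion W (p : ℤ)) γ -
          AddMonoidHom.id (subgroupH1 (κ.layerSubgroup n) (geomTorsion W (p : ℤ)))))^[ε] yn) = 0 := by
  obtain ⟨ε, hε⟩ := exists_uniform_local_exponent' W κ v hγt hγtD hsurj γ
  exact ⟨ε, fun n yn hfine =>
    resLe_eq_zero_of_resH1Hom_decompInToH_eq_zero W v (κ.layerSubgroup n) (hε n yn hfine)⟩

end Main

/-! ## (L-p) at a place above `p`, assembled, every prime -/

section LocalP

variable (W : WeierstrassCurve ℚ) [W.IsElliptic] {p : ℕ} [hp : Fact p.Prime] (κ : ZpExtension ℚ p)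
  (v : HeightOneSpectrum (𝓞 ℚ))

-- adapted from `SelmerDual.localP_of` (…X9SelmerDualLocalP, k6-c2): `hp2` deleted (it only fed part 3)
/-- **(L-p) at a place `v ∣ p`, assembled from (Lp-2) and (Lp-3), EVERY prime `p`.**  Hypotheses: `γ` a
topological generator of `κ`; (Lp-2) `hsurj`: every coset of `Gal(ℚ̄/ℚ_∞)` meets `D_v` (total
ramification of `v` in `ℚ_∞`); (Lp-3) `h3`: a uniform exponent `e` such that `loc_v(ι Ψ') = 0` forces
`loc_v(T^e Ψ') = 0` for the tower embeddings `ι : 𝒯_J ↪ 𝒯_L` of the dual twist.  Conclusion: the body of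
the hypothesis `hLp` of `SelmerDual.stub_selmerDualOdd_of_local` at this `v` (its `p ≠ 2` binder apart),
with `εp := ε + e`, `ε` the all-prime uniform local exponent `exists_uniform_local_exponent_resLe'`.
[cite: GreenbergLNM1716, §3] [cite: NeukirchSchmidtWingberg2008, I §5] -/
theorem localP_of' {γ : absoluteGaloisGroup ℚ} (hγ : κ.IsTopGenerator γ)
    (hv : ((p : ℕ) : 𝓞 ℚ) ∈ v.asIdeal)
    (hsurj : ∀ g : absoluteGaloisGroup ℚ, ∃ d ∈ decomp v, d⁻¹ * g ∈ κ.kerSubgroup)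
    (h3 : ∃ e : ℕ, ∀ {J L : ℕ} (hJL : J ≤ L) (c : galoisCohomology (W.modPTwist p κ.invTwist J) 1),
      galoisCohomology.localization (W.modPTwist p κ.invTwist L) (Sum.inr v) 1
          (galoisCohomology.map (κ.invTwist.twistModPShiftEmbed (W.torsionGaloisModule (p : ℤ))
            (fun P : geomTorsion W (p : ℤ) => AddSubgroup.torsionBy.nsmul P) L hJL) 1 c) = 0 →
        galoisCohomology.localization (W.modPTwist p κ.invTwist J) (Sum.inr v) 1
          ((κ.invTwist.shiftH1 (W.torsionGaloisModule (p : ℤ))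
            (fun P : geomTorsion W (p : ℤ) => AddSubgroup.torsionBy.nsmul P) J)^[e] c) = 0) :
    ∃ εp : ℕ, ∀ (J n : ℕ) (hJn : J + 1 ≤ p ^ n)
      (y : subgroupH1 κ.kerSubgroup (geomTorsion W (p : ℤ))),
      W.torsionToPrimaryH1Sub p κ.kerSubgroup y ∈ W.fineSelmerInfty κ →
      ∀ (yn : subgroupH1 (κ.invTwist.layerSubgroup n) (geomTorsion W (p : ℤ)))
        (Y : galoisCohomology (W.modPTwist p κ.invTwist (p ^ n)) 1)
        (Ψ : galoisCohomology (W.modPTwist p κ.invTwist (J + 1)) 1) (k : ℕ),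
        resOfLe (geomTorsion W (p : ℤ)) (κ.invTwist.kerSubgroup_le_layerSubgroup n) yn =
          resOfLe (geomTorsion W (p : ℤ)) (κ.kerSubgroup_unitTwist (-1)).le y →
        κ.invTwist.twistModPH1Equiv (W.torsionGaloisModule (p : ℤ))
          (fun P : geomTorsion W (p : ℤ) => AddSubgroup.torsionBy.nsmul P) n Y = yn →
        galoisCohomology.map (κ.invTwist.twistModPShiftEmbed (W.torsionGaloisModule (p : ℤ))
          (fun P : geomTorsion W (p : ℤ) => AddSubgroup.torsionBy.nsmul P) (p ^ n) hJn) 1 Ψ =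
          (κ.invTwist.shiftH1 (W.torsionGaloisModule (p : ℤ))
            (fun P : geomTorsion W (p : ℤ) => AddSubgroup.torsionBy.nsmul P) (p ^ n))^[k] Y →
        ∀ ε' : ℕ, εp ≤ ε' →
          galoisCohomology.localization (W.modPTwist p κ.invTwist (J + 1)) (Sum.inr v) 1
            ((κ.invTwist.shiftH1 (W.torsionGaloisModule (p : ℤ))
              (fun P : geomTorsion W (p : ℤ) => AddSubgroup.torsionBy.nsmul P) (J + 1))^[ε'] Ψ) = 0 := by
  -- a topological generator of `κ⁻¹` inside `D_v`, and total ramification for `κ⁻¹`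
  obtain ⟨d₀, hd₀D, hd₀γ⟩ := hsurj γ
  have hκd₀ : κ d₀ = Multiplicative.ofAdd 1 := by
    have h1 : κ (d₀⁻¹ * γ) = 1 := hd₀γ
    rw [map_mul, map_inv, inv_mul_eq_one] at h1
    exact h1 ▸ hγ
  have hγt : κ.invTwist.IsTopGenerator d₀⁻¹ := by
    unfold ZpExtension.IsTopGenerator
    apply Multiplicative.toAdd.injective
    rw [ZpExtension.toAdd_invTwist_apply, map_inv, toAdd_inv, neg_neg, hκd₀]
  have hγtD : d₀⁻¹ ∈ decomp v := inv_mem hd₀D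
  have hker : κ.invTwist.kerSubgroup = κ.kerSubgroup := κ.kerSubgroup_unitTwist (-1)
  have hsurj' : ∀ g : absoluteGaloisGroup ℚ, ∃ d ∈ decomp v, d⁻¹ * g ∈ κ.invTwist.kerSubgroup := by
    rw [hker]; exact hsurj
  -- the uniform local exponent `ε` of part 3 and the embed-kernel exponent `e` of (Lp-3)
  obtain ⟨ε, hε⟩ := exists_uniform_local_exponent_resLe' W κ.invTwist v hγt hγtD hsurj' γ
  obtain ⟨e, he⟩ := h3
  refine ⟨ε + e, fun J n hJn y hyfine yn Y Ψ k hyn hYyn hΨ ε' hε' => ?_⟩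
  -- (i) `(conj_γ − 1)^{[ε]} y_n` dies on `D_v ∩ Gal(ℚ̄/ℚ_n)`
  have hfine' := mem_ker_localTorsionToPrimary_invTwist W κ v y
    (resH1Hom_decompInToH_mem_ker_of_mem_fineSelmerInfty W p κ v hv hyfine)
  rw [← hyn] at hfine'
  have hres := hε n yn hfine'
  -- (ii) Shapiro: `Y = Sh⁻¹ y_n`, `T^ε Y = Sh⁻¹((conj_γ − 1)^{[ε]} y_n)`
  haveI : CompactSpace (absoluteGaloisGroup ℚ) := absoluteGaloisGroup_compactSpace ℚ
  letI : Fintype (absoluteGaloisGroup ℚ ⧸ κ.invTwist.layerSubgroup n) := κ.invTwist.fintypeQuotientLayer n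
  have hY : Y = κ.invTwist.coresShapiro (W.torsionGaloisModule (p : ℤ))
      (fun P : geomTorsion W (p : ℤ) => AddSubgroup.torsionBy.nsmul P) n yn := by
    rw [← hYyn]
    exact (κ.invTwist.coresShapiro_twistModPH1Equiv (W.torsionGaloisModule (p : ℤ)) _ n Y).symm
  have hTY : (κ.invTwist.shiftH1 (W.torsionGaloisModule (p : ℤ))
      (fun P : geomTorsion W (p : ℤ) => AddSubgroup.torsionBy.nsmul P) (p ^ n))^[ε] Y =
      κ.invTwist.coresShapiro (W.torsionGaloisModule (p : ℤ))
        (fun P : geomTorsion W (p : ℤ) => AddSubgroup.torsionBy.nsmul P) n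
        ((⇑(conjH1 (κ.invTwist.layerSubgroup n) (geomTorsion W (p : ℤ)) γ -
          AddMonoidHom.id (subgroupH1 (κ.invTwist.layerSubgroup n) (geomTorsion W (p : ℤ)))))^[ε] yn) := by
    rw [hY]
    exact (coresShapiro_invTwist_iterate_conj_sub κ n W hγ ε yn).symm
  -- (iii) Mackey at the totally ramified `v`: `res_{D_v}(T^ε Y) = 0`
  have hDN : ∀ g : absoluteGaloisGroup ℚ, ∃ d ∈ decomp v, d⁻¹ * g ∈ κ.invTwist.layerSubgroup n :=
    fun g => by
    obtain ⟨d, hd, hdg⟩ := hsurj' g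
    exact ⟨d, hd, κ.invTwist.kerSubgroup_le_layerSubgroup n hdg⟩
  have hopen : IsOpen (((decomp v ⊓ κ.invTwist.layerSubgroup n).subgroupOf (decomp v) :
      Subgroup (decomp v)) : Set (decomp v)) := by
    have hset : (((decomp v ⊓ κ.invTwist.layerSubgroup n).subgroupOf (decomp v) : Subgroup (decomp v)) :
        Set (decomp v)) = Subtype.val ⁻¹' (κ.invTwist.layerSubgroup n : Set (absoluteGaloisGroup ℚ)) := by
      ext x
      simp only [SetLike.mem_coe, Subgroup.mem_subgroupOf, Subgroup.mem_inf, Set.mem_preimage]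
      exact ⟨fun h => h.2, fun h => ⟨x.2, h⟩⟩
    rw [hset]
    exact (κ.invTwist.isOpen_layerSubgroup n).preimage continuous_subtype_val
  haveI : (κ.invTwist.layerSubgroup n).FiniteIndex :=
    ⟨by rw [κ.invTwist.index_layerSubgroup n]; exact pow_ne_zero _ hp.out.ne_zero⟩
  haveI : ((decomp v ⊓ κ.invTwist.layerSubgroup n).subgroupOf (decomp v)).FiniteIndex := by
    rw [Subgroup.inf_subgroupOf_left]; infer_instance
  letI : Fintype (decomp v ⧸ (decomp v ⊓ κ.invTwist.layerSubgroup n).subgroupOf (decomp v)) :=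
    Fintype.ofFinite _
  have hM0 : resSubgroup (κ.invTwist.twistModP (W.torsionGaloisModule (p : ℤ))
      (fun P : geomTorsion W (p : ℤ) => AddSubgroup.torsionBy.nsmul P) (p ^ n)).toTopRep (decomp v) 1
      ((κ.invTwist.shiftH1 (W.torsionGaloisModule (p : ℤ))
        (fun P : geomTorsion W (p : ℤ) => AddSubgroup.torsionBy.nsmul P) (p ^ n))^[ε] Y) = 0 := by
    rw [hTY]
    exact resSubgroup_cores_eq_zero_of_resLe_eq_zero _ (decomp v) (κ.invTwist.isOpen_layerSubgroup n)
      hDN hopen (resLe_cohomologyMap_eq_zero (W.torsionGaloisModule (p : ℤ)) _ inf_le_right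
        (κ.invTwist.unitCoeffHom (W.torsionGaloisModule (p : ℤ))
          (fun P : geomTorsion W (p : ℤ) => AddSubgroup.torsionBy.nsmul P) n) _ hres)
  -- (iv) localisation at `v`
  have hloc0 := localization_eq_zero_of_resSubgroup_eq_zero _ v _ hM0
  -- (v) the avatar `Ψ`: `ι(T^ε Ψ) = T^k (T^ε Y)`
  have hemb : galoisCohomology.map (κ.invTwist.twistModPShiftEmbed (W.torsionGaloisModule (p : ℤ))
      (fun P : geomTorsion W (p : ℤ) => AddSubgroup.torsionBy.nsmul P) (p ^ n) hJn) 1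
      ((κ.invTwist.shiftH1 (W.torsionGaloisModule (p : ℤ))
        (fun P : geomTorsion W (p : ℤ) => AddSubgroup.torsionBy.nsmul P) (J + 1))^[ε] Ψ) =
      (κ.invTwist.shiftH1 (W.torsionGaloisModule (p : ℤ))
        (fun P : geomTorsion W (p : ℤ) => AddSubgroup.torsionBy.nsmul P) (p ^ n))^[k]
        ((κ.invTwist.shiftH1 (W.torsionGaloisModule (p : ℤ))
          (fun P : geomTorsion W (p : ℤ) => AddSubgroup.torsionBy.nsmul P) (p ^ n))^[ε] Y) := by
    rw [← κ.invTwist.shiftH1_iterate_map_shiftEmbed (W.torsionGaloisModule (p : ℤ)) _ hJn ε Ψ, hΨ,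
      ← iterate_add_apply, ← iterate_add_apply, add_comm]
  have hloc1 : galoisCohomology.localization (W.modPTwist p κ.invTwist (p ^ n)) (Sum.inr v) 1
      (galoisCohomology.map (κ.invTwist.twistModPShiftEmbed (W.torsionGaloisModule (p : ℤ))
        (fun P : geomTorsion W (p : ℤ) => AddSubgroup.torsionBy.nsmul P) (p ^ n) hJn) 1
        ((κ.invTwist.shiftH1 (W.torsionGaloisModule (p : ℤ))
          (fun P : geomTorsion W (p : ℤ) => AddSubgroup.torsionBy.nsmul P) (J + 1))^[ε] Ψ)) = 0 := by
    rw [hemb]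
    change galoisCohomology.localization (κ.invTwist.twistModP (W.torsionGaloisModule (p : ℤ))
      (fun P : geomTorsion W (p : ℤ) => AddSubgroup.torsionBy.nsmul P) (p ^ n)) (Sum.inr v) 1 _ = 0
    rw [StepFour.localization_iterate_shiftH1, hloc0]
    exact Function.iterate_fixed (map_zero _) _
  -- (vi) the local embed kernel (Lp-3), then more powers of `T`
  have h2 := he hJn _ hloc1
  obtain ⟨r, rfl⟩ := Nat.exists_eq_add_of_le hε'
  rw [show ε + e + r = r + (e + ε) by ring, iterate_add_apply, iterate_add_apply]
  change galoisCohomology.localization (κ.invTwist.twistModP (W.torsionGaloisModule (p : ℤ))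
    (fun P : geomTorsion W (p : ℤ) => AddSubgroup.torsionBy.nsmul P) (J + 1)) (Sum.inr v) 1 _ = 0
  rw [StepFour.localization_iterate_shiftH1]
  have h2' : galoisCohomology.localization (κ.invTwist.twistModP (W.torsionGaloisModule (p : ℤ))
      (fun P : geomTorsion W (p : ℤ) => AddSubgroup.torsionBy.nsmul P) (J + 1)) (Sum.inr v) 1
      ((κ.invTwist.shiftH1 (W.torsionGaloisModule (p : ℤ))
        (fun P : geomTorsion W (p : ℤ) => AddSubgroup.torsionBy.nsmul P) (J + 1))^[e]
        ((κ.invTwist.shiftH1 (W.torsionGaloisModule (p : ℤ))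
          (fun P : geomTorsion W (p : ℤ) => AddSubgroup.torsionBy.nsmul P) (J + 1))^[ε] Ψ)) = 0 := h2
  rw [h2']
  exact Function.iterate_fixed (map_zero _) _

end LocalP

end Summit.BirchSwinnertonDyer.BirchSwinnertonDyer.Rank1Residual.SelmerDual

end
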